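import Literature.Probability.RandomPlanarGeometry.HexSAWSurfaceYc
import Literature.Probability.RandomPlanarGeometry.HexSAWStripIdentity
import Literature.Probability.RandomPlanarGeometry.HexSAWHammersleyWelshExplicit

/-!
# The half-plane critical surface fugacity of honeycomb SAW, IV: the growth-rate form of `y_c = 1 + √2`

Topic `Literature/Probability/RandomPlanarGeometry` — continues `HexSAWSurfaceYcFaces.lean` (T1: the half-plane partition
functions `hpGF T L x y = C⁺_{T,L}(x, y)` over the strip domains `S_{T,L}` of Duminil-Copin–Smirnov, `HalfPlaneBounded`, `ycSet`,
`hexSurfaceYc := sSup ycSet`) and `HexSAWSurfaceYc.lean` (T3: the two half-plane faces `HPBelow` / `HPAbove`, PROVED, and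
`hexSurfaceYc_eq : hexSurfaceYc = 1 + √2`, BBdGDCG14 Theorem 2 in RADIUS form).

Sources. N. R. Beaton, M. Bousquet-Mélou, J. de Gier, H. Duminil-Copin, A. J. Guttmann, *The critical fugacity for surface
adsorption of self-avoiding walks on the honeycomb lattice is `1 + √2`*, Comm. Math. Phys. 326 (2014), §3.1 (arXiv v5 p. 8:
"`C_k^+(y) := Σ_{|ω|=k} y^{c(ω)}`, where the sum runs over half-plane SAWs `ω` of length `k` and `c(ω)` denotes the number of
contacts of `ω` with the surface"; Proposition 5, p. 9: "`μ(y) := lim C_k^+(y)^{1/k}` exists [HTW82] … `μ(y) = μ` if `y ≤ y_c`,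
`> μ` if `y > y_c`"; Theorem 2 p. 3). A. Glazman, I. Manolescu, *Self-avoiding walk on the hexagonal lattice with surface
fugacity* (arXiv:1708.00395v3), Definition 1.1 and the following paragraph (p. 5): the sup-radius definition (5) of `y_c` [= the
tree's `hexSurfaceYc = sSup ycSet`], then "for fixed `y > 0`, write `x_c(y) = sup{x ≥ 0 : SAW(x, y) < ∞}` … a fugacity is
supercritical if it affects the value of the 'connective constant' of the model. This is exactly the definition of critical
fugacity used in [BBMDG+14]" — print ASSERTS radius-form `y_c` = growth-form `y_c`; this file is that bookkeeping in the kernel. J. M. Hammersley, G. M. Torrie, S. G. Whittington, J. Phys. A 15 (1982) 539 (existence of the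
limiting free energy). H. Duminil-Copin, S. Smirnov, Ann. of Math. 175 (2012), §3 (proof of Theorem 1: "`Z(x_c) ≥ Σ_T B_T = +∞`").

## What is proved (everything; no hypothesis is left open)

BBdGDCG14 define `y_c` through the GROWTH RATE of the length-`n` coefficients `C_n^+(y)` (Prop. 5), the tree's door
`hexSurfaceYc_eq` is about the sup-RADIUS `y_c` (`ycSet`).  This file closes the gap up to the existence of the limit
`lim C_n^+(y)^{1/n}` (HTW82 — NOT formalised here), with junk-free statements (explicit rates `r`, no `Filter.limsup`):
* `hpCoeff n y = C_n(y) := Σ_{γ : a → mid-edge, ℓ(γ) = n mid-edge steps = n visited vertices, γ in the half-plane} y^{#surface vertices}`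
  (over `midWalks (stripV n n)`: BOX EXHAUSTION `isMidWalk_box` — an `n`-vertex mid-edge walk from `a` stays in `S_{n,n}`);
* **`halfPlaneBounded_iff_summable (hx : 0 ≤ x) (hy : 0 ≤ y) : HalfPlaneBounded x y ↔ Summable (fun n => hpCoeff n y * x ^ n)`**;
* `GrowthLe y` ("`limsup C_n(y)^{1/n} ≤ μ`": `∀ r > μ, ∀ᶠ n, C_n(y) ≤ rⁿ`), `GrowthGt y` ("`> μ`": `∃ r > μ, ∃ᶠ n, rⁿ ≤ C_n(y)`),
  `GrowthGe y` ("`≥ μ`": `∀ 0 ≤ r < μ, ∃ᶠ n, rⁿ ≤ C_n(y)`), with `μ = hexConnectiveConstant = x_c⁻¹`;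
* `growthLe_holds : 0 < y → y < 1 + √2 → GrowthLe y` (from T3's `hpBelow_holds`), `growthGt_holds : 1 + √2 < y → GrowthGt y` (from
  `hpAbove_holds`), `growthGe_of_one_le : 1 ≤ y → GrowthGe y` and `not_halfPlaneBounded_criticalFugacity : 1 ≤ y → ¬ HalfPlaneBounded x_c y`
  (from DCS's `Σ_T B_T(x_c) = +∞`: tree `tendsto_sum_stripBlim_atTop`, `tendsto_stripB`, `sum_stripB_le`);
* headline **`growthLe_iff (hy0 : 0 < y) (hne : y ≠ 1 + Real.sqrt 2) : GrowthLe y ↔ y < 1 + Real.sqrt 2`** — BBdGDCG14 Theorem 2 in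
  growth-rate (limsup) form, off the critical point; and `growth_eq_holds : 1 ≤ y → y < 1 + √2 → GrowthLe y ∧ GrowthGe y`;
* `growthGe_of_pos : 0 < y → GrowthGe y` (Prop. 5 "For `0 < y ≤ 1`, `μ(y) = μ`": the lift `γ ↦ a · O · σ(γ)` one hexagon row
  off the surface, `mul_hpCoeff_one_le : y * C_n(1) ≤ C_{n+2}(y)`), hence `growth_eq_holds_of_pos : 0 < y → y < 1 + √2 → GrowthLe y ∧ GrowthGe y`.
* the endpoint: `growthLe_criticalPoint : GrowthLe (1 + √2)` by the rescaling bound `hpCoeff_le_pow_mul : C_n(y') ≤ (y'/y)ⁿ C_n(y)`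
  (no limit, no convexity), hence the FULL dichotomy **`growthLe_iff_le (hy0 : 0 < y) : GrowthLe y ↔ y ≤ 1 + Real.sqrt 2`**,
  `growthGt_iff (hy0 : 0 < y) : GrowthGt y ↔ 1 + Real.sqrt 2 < y`, `growth_eq_holds_of_le`, and
  **`growthLe_iff_le_hexSurfaceYc (hy0 : 0 < y) : GrowthLe y ↔ y ≤ hexSurfaceYc`** (the tree's sup-radius `y_c` is the growth threshold).
Not decided here: only the existence of `lim C_n(y)^{1/n}` (HTW82).
LABEL (lane pcv-sawmu, lit-1 g13 cell of record 2026-08-23): CONSOLIDATION, with a printed anchor for the very equivalence the file proves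
(Glazman–Manolescu, Definition 1.1 ff., arXiv v3 p. 5) — growth-rate form of a landed theorem; box exhaustion / root test / the row lift are folklore.
[cite: GlazmanManolescu2019, Definition 1.1 and the following paragraph (arXiv v3 p. 5: the sup-radius definition (5) and "This is exactly the definition of critical fugacity used in [BBMDG+14]")]
-/

noncomputable section

open Finset Filter Topology
open Literature.Probability.LatticeModels Literature.Probability.Percolation

namespace Literature.Probability.RandomPlanarGeometry.SAW.HV

/-! ### Vocabulary -/

/-- **`C_n(y)`** — the length-`n` coefficient of the half-plane partition function: mid-edge walks `γ : a → z` with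
`ℓ(γ) = n` visited vertices in the upper half-plane (equivalently in the box `S_{n,n}`, see `isMidWalk_box`), weighted
`y^{#{visited vertices on the surface row}}`.
[cite: BeatonBousquetMelouDeGierDuminilCopinGuttmann2014, §3.1 (arXiv v5 p. 8: "C_k^+(y) := Σ_{|ω|=k} y^{c(ω)}, where the sum runs over half-plane SAWs ω of length k and c(ω) denotes the number of contacts of ω with the surface")] -/
def hpCoeff (n : ℕ) (y : ℝ) : ℝ :=
  ∑ P ∈ (midWalks (stripV n n)).filter (fun P => mwLen P = n), y ^ botContacts P

/-- `C_n(y) ≥ 0` for `y ≥ 0`. [cite: BeatonBousquetMelouDeGierDuminilCopinGuttmann2014, §3.1 (arXiv v5 p. 8: `C_k^+(y)` "a polynomial in `y`")] -/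
theorem hpCoeff_nonneg (n : ℕ) {y : ℝ} (hy : 0 ≤ y) : 0 ≤ hpCoeff n y :=
  sum_nonneg fun _ _ => pow_nonneg hy _

/-- `C_n(·)` is non-decreasing on `[0, ∞)`. [cite: BeatonBousquetMelouDeGierDuminilCopinGuttmann2014, §3.1 (arXiv v5 p. 8: `C_k^+(y)` "a polynomial in `y`" — with non-negative coefficients; Proposition 5, p. 9: `μ(·)` "non-decreasing")] -/
theorem hpCoeff_mono (n : ℕ) {y y' : ℝ} (hy : 0 ≤ y) (hyy' : y ≤ y') : hpCoeff n y ≤ hpCoeff n y' :=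
  sum_le_sum fun _ _ => pow_le_pow_left₀ hy hyy' _

/-- **"`limsup_n C_n(y)^{1/n} ≤ μ`"**, junk-free: every rate above `μ` eventually dominates.
[cite: BeatonBousquetMelouDeGierDuminilCopinGuttmann2014, §3.1, Proposition 5 (arXiv v5 p. 9: "μ(y) = μ if y ≤ y_c")] -/
def GrowthLe (y : ℝ) : Prop := ∀ r : ℝ, hexConnectiveConstant < r → ∀ᶠ n : ℕ in atTop, hpCoeff n y ≤ r ^ n

/-- **"`limsup_n C_n(y)^{1/n} > μ`"**, junk-free: some rate above `μ` is reached infinitely often.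
[cite: BeatonBousquetMelouDeGierDuminilCopinGuttmann2014, §3.1, Proposition 5 (arXiv v5 p. 9: "μ(y) > μ if y > y_c")] -/
def GrowthGt (y : ℝ) : Prop := ∃ r : ℝ, hexConnectiveConstant < r ∧ ∃ᶠ n : ℕ in atTop, r ^ n ≤ hpCoeff n y

/-- **"`limsup_n C_n(y)^{1/n} ≥ μ`"**, junk-free: every rate below `μ` is reached infinitely often.
[cite: BeatonBousquetMelouDeGierDuminilCopinGuttmann2014, §3.1, Proposition 5 (arXiv v5 p. 9: "μ(y) ≥ max(μ, √y)" — the `μ` half)] -/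
def GrowthGe (y : ℝ) : Prop := ∀ r : ℝ, 0 ≤ r → r < hexConnectiveConstant → ∃ᶠ n : ℕ in atTop, r ^ n ≤ hpCoeff n y

/-! ### Box exhaustion: an `n`-vertex mid-edge walk from `a` stays in `S_{n,n}` -/

/-- One lattice step moves the abscissa `x₀` and the level by at most one. [cite: DuminilCopinSmirnov2012, §3 (Fig. 3: the levels)] -/
theorem adj_coord_step {u v : HV} (h : hvGraph.Adj u v) :
    v.1 ≤ u.1 + 1 ∧ u.1 ≤ v.1 + 1 ∧ lev v ≤ lev u + 1 ∧ lev u ≤ lev v + 1 := by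
  obtain ⟨a, b, c⟩ := u
  obtain ⟨a', b', c'⟩ := v
  rw [hvGraph_adj] at h
  cases c <;> cases c' <;> simp [HV.AdjRel] at h ⊢ <;> omega

/-- Along a lattice chain `u, v₁, …, v_m` every vertex is within `m` of `u` in abscissa and in level.
[cite: DuminilCopinSmirnov2012, §3 (Fig. 3: the levels)] -/
theorem isChain_coord_bound : ∀ (u : HV) (M : List HV), (u :: M).IsChain hvGraph.Adj →
    ∀ v ∈ u :: M, v.1 ≤ u.1 + M.length ∧ u.1 ≤ v.1 + M.length ∧
      lev v ≤ lev u + M.length ∧ lev u ≤ lev v + M.length := by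
  intro u M
  induction M generalizing u with
  | nil =>
    intro _ v hv
    rw [List.mem_singleton] at hv
    subst hv
    simp
  | cons u' M ih =>
    intro hc v hv
    rw [List.isChain_cons_cons] at hc
    obtain ⟨hadj, hc'⟩ := hc
    have hs := adj_coord_step hadj
    simp only [List.length_cons, Nat.cast_add, Nat.cast_one]
    rcases List.mem_cons.1 hv with rfl | hv'
    · refine ⟨?_, ?_, ?_, ?_⟩ <;> linarith
    · have := ih u' hc' v hv'
      omega

/-- The visited vertices of a mid-edge walk `γ` from `a` are within `ℓ(γ)` of the origin in abscissa and level.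
[cite: DuminilCopinSmirnov2012, §1 (γ : a → z, ℓ(γ) vertices)] -/
theorem IsMidWalk.inner_coord_bound {V : Finset HV} {P : List HV} (hP : IsMidWalk V P) :
    ∀ v ∈ HV.inner P, v.1 ≤ mwLen P ∧ -(mwLen P : ℤ) ≤ v.1 ∧ lev v ≤ mwLen P := by
  obtain ⟨Q, rfl⟩ := hP.exists_eq_cons
  have hc : (hvOrigin :: Q).IsChain hvGraph.Adj := (List.isChain_cons_cons.1 hP.1).2
  intro v hv
  have hmem : v ∈ hvOrigin :: Q := by
    have hv' : v ∈ (hvOrigin :: Q).dropLast := by simpa [HV.inner] using hv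
    exact List.mem_of_mem_dropLast hv'
  have hb := isChain_coord_bound hvOrigin Q hc v hmem
  have hlen : mwLen (wOut :: hvOrigin :: Q) = Q.length := by simp [mwLen]
  rw [hlen]
  simp [hvOrigin] at hb
  omega

/-- **Box exhaustion**: a mid-edge walk from `a` with `ℓ(γ) = n` visited vertices, all in the upper half-plane, is a
mid-edge walk of the strip domain `S_{n,n}`. [cite: DuminilCopinSmirnov2012, §3 (S_{T,L})] -/
theorem isMidWalk_box {V : Finset HV} {P : List HV} (hP : IsMidWalk V P) (hV : ∀ v ∈ HV.inner P, 0 ≤ v.2.1) :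
    IsMidWalk (stripV (mwLen P) (mwLen P)) P := by
  obtain ⟨hc, hh, ht, hin, hnd, hlast⟩ := hP
  refine ⟨hc, hh, ht, fun v hv => ?_, hnd, hlast⟩
  have hb := IsMidWalk.inner_coord_bound ⟨hc, hh, ht, hin, hnd, hlast⟩ v hv
  have h0 := hV v hv
  have hn : 1 ≤ mwLen P := by
    rw [← IsMidWalk.length_inner ⟨hc, hh, ht, hin, hnd, hlast⟩]
    exact List.length_pos_of_mem hv
  have hbit : 0 ≤ bit v ∧ bit v ≤ 1 := by unfold bit; split <;> simp
  rw [mem_stripV_iff]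
  refine ⟨h0, ?_, ?_, hb.1⟩
  · have : (1 : ℤ) ≤ mwLen P := by exact_mod_cast hn
    linarith [hb.2.2]
  · linarith [hb.2.1]

/-- Box exhaustion for walks of a strip domain: `γ ⊂ S_{T,L}` with `ℓ(γ) = n` lies in `S_{n,n}`. [cite: DuminilCopinSmirnov2012, §3 (S_{T,L})] -/
theorem isMidWalk_box' {T L : ℕ} {P : List HV} (hP : IsMidWalk (stripV T L) P) :
    IsMidWalk (stripV (mwLen P) (mwLen P)) P :=
  isMidWalk_box hP fun v hv => (mem_stripV_iff.1 (hP.2.2.2.1 v hv)).1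

/-- The length-`n` fibre of the mid-edge walks of ANY strip domain sits inside the one defining `C_n`.
[cite: DuminilCopinSmirnov2012, §3 (S_{T,L})] -/
theorem hpFibre_subset (T L n : ℕ) :
    (midWalks (stripV T L)).filter (fun P => mwLen P = n) ⊆ (midWalks (stripV n n)).filter (fun P => mwLen P = n) := by
  intro P hP
  rw [mem_filter] at hP ⊢
  refine ⟨?_, hP.2⟩
  rw [mem_midWalks_iff] at hP ⊢
  have := isMidWalk_box' hP.1
  rwa [hP.2] at this

/-! ### `HalfPlaneBounded x y ↔ Σ_n C_n(y) xⁿ < ∞` -/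

/-- Partial sums of the coefficient series are bounded by the box `S_{N,N}`: `Σ_{n ≤ N} C_n(y) xⁿ ≤ C⁺_{N,N}(x, y)`.
[cite: GlazmanManolescu2019, (4)–(5) and x_c(y) (arXiv v3 p. 5: the two-variable half-plane series SAW(x, y) and its radius); BeatonBousquetMelouDeGierDuminilCopinGuttmann2014, §3.1 (arXiv v5 p. 8: `C_k^+(y)`)] -/
theorem sum_range_hpCoeff_le (N : ℕ) {x y : ℝ} (hx : 0 ≤ x) (hy : 0 ≤ y) :
    ∑ n ∈ range (N + 1), hpCoeff n y * x ^ n ≤ hpGF N N x y := by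
  set F : ℕ → Finset (List HV) := fun n => (midWalks (stripV n n)).filter (fun P => mwLen P = n) with hF
  have hdisj : ∀ n ∈ range (N + 1), ∀ m ∈ range (N + 1), n ≠ m → Disjoint (F n) (F m) := by
    intro n _ m _ hnm
    rw [Finset.disjoint_left]
    intro P hPn hPm
    exact hnm ((mem_filter.1 hPn).2.symm.trans (mem_filter.1 hPm).2)
  calc ∑ n ∈ range (N + 1), hpCoeff n y * x ^ n
      = ∑ n ∈ range (N + 1), ∑ P ∈ F n, x ^ mwLen P * y ^ botContacts P := by
        refine sum_congr rfl fun n _ => ?_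
        rw [hpCoeff, sum_mul]
        refine sum_congr rfl fun P hP => ?_
        rw [(mem_filter.1 hP).2]; ring
    _ = ∑ P ∈ (range (N + 1)).biUnion F, x ^ mwLen P * y ^ botContacts P := (sum_biUnion hdisj).symm
    _ ≤ hpGF N N x y := by
        refine sum_le_sum_of_subset_of_nonneg ?_ fun _ _ _ => mul_nonneg (pow_nonneg hx _) (pow_nonneg hy _)
        intro P hP
        rw [mem_biUnion] at hP
        obtain ⟨n, hn, hP⟩ := hP
        rw [mem_range] at hn
        have hPn := (mem_filter.1 hP).1
        rw [mem_midWalks_iff] at hPn ⊢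
        exact hPn.mono ((stripV_mono_T (by omega)).trans (stripV_mono_L (by omega)))

/-- Every box is dominated by the full series: `C⁺_{T,L}(x, y) ≤ Σ_n C_n(y) xⁿ` (when the series converges).
[cite: GlazmanManolescu2019, (4)–(5) and x_c(y) (arXiv v3 p. 5: the two-variable half-plane series SAW(x, y) and its radius); BeatonBousquetMelouDeGierDuminilCopinGuttmann2014, §3.1 (arXiv v5 p. 8: `C_k^+(y)`)] -/
theorem hpGF_le_tsum (T L : ℕ) {x y : ℝ} (hx : 0 ≤ x) (hy : 0 ≤ y) (hs : Summable fun n => hpCoeff n y * x ^ n) :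
    hpGF T L x y ≤ ∑' n, hpCoeff n y * x ^ n := by
  set MW := midWalks (stripV T L) with hMW
  set B := MW.sup mwLen + 1 with hB
  have hmaps : ∀ P ∈ MW, mwLen P ∈ range B := fun P hP => mem_range.2 (Nat.lt_succ_of_le (le_sup hP))
  have h1 : hpGF T L x y = ∑ n ∈ range B, ∑ P ∈ MW.filter (fun P => mwLen P = n), x ^ mwLen P * y ^ botContacts P := by
    rw [hpGF, sum_fiberwise_of_maps_to hmaps]
  have h2 : ∀ n, ∑ P ∈ MW.filter (fun P => mwLen P = n), x ^ mwLen P * y ^ botContacts P ≤ hpCoeff n y * x ^ n := by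
    intro n
    calc ∑ P ∈ MW.filter (fun P => mwLen P = n), x ^ mwLen P * y ^ botContacts P
        = ∑ P ∈ MW.filter (fun P => mwLen P = n), y ^ botContacts P * x ^ n := by
          refine sum_congr rfl fun P hP => ?_
          rw [(mem_filter.1 hP).2]; ring
      _ ≤ ∑ P ∈ (midWalks (stripV n n)).filter (fun P => mwLen P = n), y ^ botContacts P * x ^ n :=
          sum_le_sum_of_subset_of_nonneg (hpFibre_subset T L n) fun _ _ _ => mul_nonneg (pow_nonneg hy _) (pow_nonneg hx _)
      _ = hpCoeff n y * x ^ n := by rw [hpCoeff, sum_mul]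
  rw [h1]
  calc ∑ n ∈ range B, ∑ P ∈ MW.filter (fun P => mwLen P = n), x ^ mwLen P * y ^ botContacts P
      ≤ ∑ n ∈ range B, hpCoeff n y * x ^ n := sum_le_sum fun n _ => h2 n
    _ ≤ ∑' n, hpCoeff n y * x ^ n :=
        hs.sum_le_tsum _ fun n _ => mul_nonneg (hpCoeff_nonneg n hy) (pow_nonneg hx _)

/-- **Box exhaustion ⇔ summability**: the half-plane partition function is bounded over all boxes iff the coefficient
series `Σ_n C_n(y) xⁿ` converges (`x, y ≥ 0`). [cite: GlazmanManolescu2019, (4)–(5) and x_c(y) (arXiv v3 p. 5: the two-variable half-plane series SAW(x, y) and its radius); BeatonBousquetMelouDeGierDuminilCopinGuttmann2014, §3.1 (arXiv v5 p. 8: `C_k^+(y)`)] -/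
theorem halfPlaneBounded_iff_summable {x y : ℝ} (hx : 0 ≤ x) (hy : 0 ≤ y) :
    HalfPlaneBounded x y ↔ Summable fun n => hpCoeff n y * x ^ n := by
  constructor
  · rintro ⟨K, hK⟩
    refine summable_of_sum_range_le (c := K) (fun n => mul_nonneg (hpCoeff_nonneg n hy) (pow_nonneg hx n)) fun N => ?_
    calc ∑ n ∈ range N, hpCoeff n y * x ^ n
        ≤ ∑ n ∈ range (N + 1), hpCoeff n y * x ^ n :=
          sum_le_sum_of_subset_of_nonneg (range_mono (Nat.le_succ N))
            fun n _ _ => mul_nonneg (hpCoeff_nonneg n hy) (pow_nonneg hx n)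
      _ ≤ hpGF N N x y := sum_range_hpCoeff_le N hx hy
      _ ≤ K := hK ⟨(N, N), rfl⟩
  · intro hs
    exact ⟨∑' n, hpCoeff n y * x ^ n, by rintro _ ⟨⟨T, L⟩, rfl⟩; exact hpGF_le_tsum T L hx hy hs⟩

/-! ### Growth-rate consequences -/

/-- **`y ∈ ycSet` ⇒ `limsup C_n(y)^{1/n} ≤ μ`.** [cite: BeatonBousquetMelouDeGierDuminilCopinGuttmann2014, §3.1, Proposition 5 (arXiv v5 p. 9)] -/
theorem growthLe_of_mem_ycSet {y : ℝ} (hy : y ∈ ycSet) : GrowthLe y := by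
  intro r hr
  have hxc := hexCriticalFugacity_pos_lt_one.1
  have hr0 : 0 < r := lt_trans (by rw [hexConnectiveConstant_eq_inv]; positivity) hr
  have hx0 : 0 < r⁻¹ := inv_pos.2 hr0
  have hxlt : r⁻¹ < hexCriticalFugacity := by
    rw [hexConnectiveConstant_eq_inv] at hr
    calc r⁻¹ < hexCriticalFugacity⁻¹⁻¹ := inv_strictAnti₀ (inv_pos.2 hxc) hr
      _ = hexCriticalFugacity := inv_inv _
  have hs := (halfPlaneBounded_iff_summable hx0.le hy.1).1 (hy.2 r⁻¹ hx0 hxlt)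
  have ht := hs.tendsto_atTop_zero
  filter_upwards [ht.eventually (gt_mem_nhds zero_lt_one)] with n hn
  rw [inv_pow, mul_inv_lt_iff₀ (pow_pos hr0 n), one_mul] at hn
  exact hn.le

/-- **`C⁺(x, y)` unbounded at some `x < x_c` ⇒ `limsup C_n(y)^{1/n} > μ`** (`y ≥ 0`): eventual domination by a rate `r` with
`r x < 1` would make `Σ_n C_n(y) xⁿ` converge. [cite: BeatonBousquetMelouDeGierDuminilCopinGuttmann2014, §3.1, Proposition 5 (arXiv v5 p. 9)] -/
theorem growthGt_of_not_halfPlaneBounded {x y : ℝ} (hy : 0 ≤ y) (hx : 0 < x) (hxc : x < hexCriticalFugacity)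
    (hnb : ¬ HalfPlaneBounded x y) : GrowthGt y := by
  have hxc0 := hexCriticalFugacity_pos_lt_one.1
  -- the rate `r := (x⁻¹ + x_c⁻¹)/2` lies strictly between `μ = x_c⁻¹` and `x⁻¹`
  have hinv : hexCriticalFugacity⁻¹ < x⁻¹ := inv_strictAnti₀ hx hxc
  refine ⟨(x⁻¹ + hexCriticalFugacity⁻¹) / 2, by rw [hexConnectiveConstant_eq_inv]; linarith, ?_⟩
  set r : ℝ := (x⁻¹ + hexCriticalFugacity⁻¹) / 2 with hr
  have hr0 : 0 < r := by rw [hr]; positivity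
  have hq1 : r * x < 1 := by
    have : r < x⁻¹ := by rw [hr]; linarith
    calc r * x < x⁻¹ * x := mul_lt_mul_of_pos_right this hx
      _ = 1 := inv_mul_cancel₀ hx.ne'
  have hq0 : 0 ≤ r * x := by positivity
  by_contra hcon
  rw [Filter.not_frequently] at hcon
  apply hnb
  rw [halfPlaneBounded_iff_summable hx.le hy]
  refine Summable.of_norm_bounded_eventually_nat (g := fun n => (r * x) ^ n) (summable_geometric_of_lt_one hq0 hq1) ?_
  filter_upwards [hcon] with n hn
  rw [not_le] at hn
  rw [Real.norm_of_nonneg (mul_nonneg (hpCoeff_nonneg n hy) (pow_nonneg hx.le n)), mul_pow]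
  exact mul_le_mul_of_nonneg_right hn.le (pow_nonneg hx.le n)

/-- **DCS at the surface: `C⁺(x_c, y)` is unbounded for every `y ≥ 1`**, from `Z(x_c) ≥ Σ_{T} B_T(x_c) = +∞`
(`B_{T,L}(x_c) → B_T`, `Σ_{T ≤ N} B_{T,L}(x_c) ≤ Σ_{γ ⊂ S_{N,L}} x_c^{ℓ(γ)} ≤ C⁺_{N,L}(x_c, y)`).
[cite: DuminilCopinSmirnov2012, §3 (proof of Theorem 1: "Z(x_c) ≥ Σ_T B_T = +∞")] -/
theorem not_halfPlaneBounded_criticalFugacity {y : ℝ} (hy : 1 ≤ y) : ¬ HalfPlaneBounded hexCriticalFugacity y := by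
  have hxc0 := hexCriticalFugacity_pos_lt_one.1
  rintro ⟨K, hK⟩
  obtain ⟨N, hN⟩ := (tendsto_sum_stripBlim_atTop.eventually_gt_atTop (K + 1)).exists
  have hlim : Tendsto (fun L : ℕ => ∑ T ∈ range N, stripB (T + 1) L hexCriticalFugacity) atTop
      (𝓝 (∑ T ∈ range N, stripBlim (T + 1))) :=
    tendsto_finsetSum _ fun T _ => tendsto_stripB DuminilCopinSmirnov2012_lemma2_holds (by omega)
  obtain ⟨L, hL⟩ := (hlim.eventually (lt_mem_nhds hN)).exists
  have h1 : ∑ T ∈ range N, stripB (T + 1) L hexCriticalFugacity ≤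
      ∑ P ∈ midWalks (stripV N L), hexCriticalFugacity ^ mwLen P := sum_stripB_le N L hxc0.le
  have h2 : ∑ P ∈ midWalks (stripV N L), hexCriticalFugacity ^ mwLen P ≤ hpGF N L hexCriticalFugacity y := by
    rw [hpGF]
    exact sum_le_sum fun P _ => le_mul_of_one_le_right (pow_nonneg hxc0.le _) (one_le_pow₀ hy)
  have h3 : hpGF N L hexCriticalFugacity y ≤ K := hK ⟨(N, L), rfl⟩
  linarith

/-- **`y ≥ 1` ⇒ `limsup C_n(y)^{1/n} ≥ μ`**, UNCONDITIONALLY (no surface input): eventual domination by a rate `r < μ`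
would make `Σ_n C_n(y) x_cⁿ` converge, contradicting `not_halfPlaneBounded_criticalFugacity`.
[cite: BeatonBousquetMelouDeGierDuminilCopinGuttmann2014, §3.1, Proposition 5 (arXiv v5 p. 9: "μ(y) ≥ max(μ, √y)" — the `μ` half); DuminilCopinSmirnov2012, §3 (proof of Theorem 1: "Z(x_c) ≥ Σ_T B_T = +∞")] -/
theorem growthGe_of_one_le {y : ℝ} (hy : 1 ≤ y) : GrowthGe y := by
  intro r hr0 hr
  have hxc0 := hexCriticalFugacity_pos_lt_one.1
  have hy0 : 0 ≤ y := zero_le_one.trans hy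
  have hq1 : r * hexCriticalFugacity < 1 := by
    rw [hexConnectiveConstant_eq_inv] at hr
    calc r * hexCriticalFugacity < hexCriticalFugacity⁻¹ * hexCriticalFugacity := mul_lt_mul_of_pos_right hr hxc0
      _ = 1 := inv_mul_cancel₀ hxc0.ne'
  have hq0 : 0 ≤ r * hexCriticalFugacity := by positivity
  by_contra hcon
  rw [Filter.not_frequently] at hcon
  apply not_halfPlaneBounded_criticalFugacity hy
  rw [halfPlaneBounded_iff_summable hxc0.le hy0]
  refine Summable.of_norm_bounded_eventually_nat (g := fun n => (r * hexCriticalFugacity) ^ n)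
    (summable_geometric_of_lt_one hq0 hq1) ?_
  filter_upwards [hcon] with n hn
  rw [not_le] at hn
  rw [Real.norm_of_nonneg (mul_nonneg (hpCoeff_nonneg n hy0) (pow_nonneg hxc0.le n)), mul_pow]
  exact mul_le_mul_of_nonneg_right hn.le (pow_nonneg hxc0.le n)

/-- `GrowthGt` excludes `GrowthLe`. [cite: BeatonBousquetMelouDeGierDuminilCopinGuttmann2014, §3.1, Proposition 5 (arXiv v5 p. 9)] -/
theorem not_growthLe_of_growthGt {y : ℝ} (h : GrowthGt y) : ¬ GrowthLe y := by
  obtain ⟨r, hr, hfr⟩ := h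
  intro hle
  have hμ0 : 0 < hexConnectiveConstant := by rw [hexConnectiveConstant_eq_inv]; exact inv_pos.2 hexCriticalFugacity_pos_lt_one.1
  set r' : ℝ := (hexConnectiveConstant + r) / 2 with hr'
  have h1 : hexConnectiveConstant < r' := by rw [hr']; linarith
  have h2 : r' < r := by rw [hr']; linarith
  have h0 : 0 ≤ r' := by rw [hr']; linarith
  have hev := (hle r' h1).and (eventually_ge_atTop 1)
  obtain ⟨n, hn, hle', hn1⟩ := (hfr.and_eventually hev).exists
  have : r' ^ n < r ^ n := pow_lt_pow_left₀ h2 h0 (by omega)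
  linarith

/-! ### The printed theorem in growth-rate form (over T3's two half-plane faces, by name) -/

/-- **Desorbed side: `0 < y < 1 + √2` ⇒ `limsup C_n(y)^{1/n} ≤ μ`.** Input: `HPBelow` (T3, `hpBelow_holds`).
[cite: BeatonBousquetMelouDeGierDuminilCopinGuttmann2014, Theorem 2 (arXiv v5 p. 3) with §3.1, Proposition 5 (p. 9)] -/
theorem growthLe_of_lt (hBel : HPBelow) {y : ℝ} (hy0 : 0 < y) (hy : y < 1 + Real.sqrt 2) : GrowthLe y :=
  growthLe_of_mem_ycSet ⟨hy0.le, fun x hx hxc => hBel y hy0 hy x hx hxc⟩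

/-- **Adsorbed side: `y > 1 + √2` ⇒ `limsup C_n(y)^{1/n} > μ`.** Input: `HPAbove` (T3, `hpAbove_holds`).
[cite: BeatonBousquetMelouDeGierDuminilCopinGuttmann2014, Theorem 2 (arXiv v5 p. 3) with §3.1, Proposition 5 (p. 9)] -/
theorem growthGt_of_gt (hAb : HPAbove) {y : ℝ} (hy : 1 + Real.sqrt 2 < y) : GrowthGt y := by
  obtain ⟨x, hx, hxc, hnb⟩ := hAb y hy
  have hy0 : 0 ≤ y := by
    have := Real.sqrt_nonneg 2
    linarith
  exact growthGt_of_not_halfPlaneBounded hy0 hx hxc hnb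

/-- **Two-sided at `1 ≤ y < 1 + √2`: `limsup C_n(y)^{1/n} = μ`** (both junk-free halves).
[cite: BeatonBousquetMelouDeGierDuminilCopinGuttmann2014, §3.1, Proposition 5 (arXiv v5 p. 9: "μ(y) = μ if y ≤ y_c")] -/
theorem growth_eq_of_one_le_lt (hBel : HPBelow) {y : ℝ} (hy1 : 1 ≤ y) (hy : y < 1 + Real.sqrt 2) :
    GrowthLe y ∧ GrowthGe y :=
  ⟨growthLe_of_lt hBel (zero_lt_one.trans_le hy1) hy, growthGe_of_one_le hy1⟩

/-- **BBdGDCG14 Theorem 2 in growth-rate form** (off the critical point): for `0 < y ≠ 1 + √2`, the half-plane coefficient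
sequence grows at rate at most `μ` iff `y < 1 + √2`. Inputs: `HPBelow` / `HPAbove` (T3: `hpBelow_holds` / `hpAbove_holds`).
The value AT `y = 1 + √2` is `growthLe_criticalPoint` / `growthLe_iff_le` below (rescaling; no T-A′ at `y*` needed); not decided in
this file: the existence of `lim C_n(y)^{1/n}` (HTW82).
[cite: BeatonBousquetMelouDeGierDuminilCopinGuttmann2014, Theorem 2 (arXiv v5 p. 3) with §3.1, Proposition 5 (p. 9); HammersleyTorrieWhittington1982 (existence of lim C_n(y)^{1/n}, as invoked in BBdGDCG14, proof of Prop. 5)] -/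
theorem growthLe_iff_of_faces (hBel : HPBelow) (hAb : HPAbove) {y : ℝ} (hy0 : 0 < y) (hne : y ≠ 1 + Real.sqrt 2) :
    GrowthLe y ↔ y < 1 + Real.sqrt 2 := by
  constructor
  · intro h
    by_contra hge
    rw [not_lt] at hge
    exact not_growthLe_of_growthGt (growthGt_of_gt hAb (lt_of_le_of_ne hge (Ne.symm hne))) h
  · exact growthLe_of_lt hBel hy0

/-! ### Discharged by import: T3 is in the tree (p359345), so the headline carries no surface hypothesis -/

/-- **`0 < y < 1 + √2` ⇒ `limsup C_n(y)^{1/n} ≤ μ`**, unconditionally.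
[cite: BeatonBousquetMelouDeGierDuminilCopinGuttmann2014, Theorem 2 (arXiv v5 p. 3) with §3.1, Proposition 5 (p. 9)] -/
theorem growthLe_holds {y : ℝ} (hy0 : 0 < y) (hy : y < 1 + Real.sqrt 2) : GrowthLe y := growthLe_of_lt hpBelow_holds hy0 hy

/-- **`y > 1 + √2` ⇒ `limsup C_n(y)^{1/n} > μ`**, unconditionally.
[cite: BeatonBousquetMelouDeGierDuminilCopinGuttmann2014, Theorem 2 (arXiv v5 p. 3) with §3.1, Proposition 5 (p. 9)] -/
theorem growthGt_holds {y : ℝ} (hy : 1 + Real.sqrt 2 < y) : GrowthGt y := growthGt_of_gt hpAbove_holds hy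

/-- **`1 ≤ y < 1 + √2` ⇒ `limsup C_n(y)^{1/n} = μ`** (both halves), unconditionally.
[cite: BeatonBousquetMelouDeGierDuminilCopinGuttmann2014, §3.1, Proposition 5 (arXiv v5 p. 9: "μ(y) = μ if y ≤ y_c")] -/
theorem growth_eq_holds {y : ℝ} (hy1 : 1 ≤ y) (hy : y < 1 + Real.sqrt 2) : GrowthLe y ∧ GrowthGe y :=
  growth_eq_of_one_le_lt hpBelow_holds hy1 hy

/-- **BBdGDCG14 Theorem 2 in growth-rate form, NO hypothesis beyond `0 < y ≠ 1 + √2`:** `limsup C_n(y)^{1/n} ≤ μ ↔ y < 1 + √2`.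
[cite: BeatonBousquetMelouDeGierDuminilCopinGuttmann2014, Theorem 2 (arXiv v5 p. 3) with §3.1, Proposition 5 (p. 9)] -/
theorem growthLe_iff {y : ℝ} (hy0 : 0 < y) (hne : y ≠ 1 + Real.sqrt 2) : GrowthLe y ↔ y < 1 + Real.sqrt 2 :=
  growthLe_iff_of_faces hpBelow_holds hpAbove_holds hy0 hne


/-! ### `μ(y) ≥ μ` for EVERY `y > 0`: lifting bulk walks one row off the surface

BBdGDCG14 Prop. 5 (arXiv v5 p. 9): "For `0 < y ≤ 1`, `μ(y) = μ`" (the half-plane growth constant equals the bulk one, [W75] as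
cited there).  The monotone half `C_n(y) ≤ C_n(1)` is `hpCoeff_mono`; the other half is the injection `γ ↦ a · O · σ(γ)`: translate
`γ` up by one hexagon row (`σ (x₀, x₁, b) = (x₀, x₁ + 1, b)`, a graph automorphism raising the level by `2`, with `σ(w) =
(0, 0, true)` the up-neighbour of `O`) and prepend the stem `w → O`; the image visits `n + 2` vertices, exactly ONE of them
(`O`) on the surface row, whence `y · C_n(1) ≤ C_{n+2}(y)` for every `y ≥ 0` and `GrowthGe y` for all `y > 0`. -/

/-- Translation by one hexagon row, `σ (x₀, x₁, b) = (x₀, x₁ + 1, b)` (two levels up). [cite: DuminilCopinSmirnov2012, §3 (Fig. 3: the levels)] -/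
def shiftUp (v : HV) : HV := (v.1, v.2.1 + 1, v.2.2)

/-- `σ` is injective. [cite: DuminilCopinSmirnov2012, §3 (Fig. 3: the levels)] -/
theorem shiftUp_injective : Function.Injective shiftUp := by
  rintro ⟨a, b, c⟩ ⟨a', b', c'⟩ h
  simp only [shiftUp, Prod.mk.injEq] at h
  obtain ⟨h1, h2, h3⟩ := h
  exact Prod.ext h1 (Prod.ext (by simpa using h2) h3)

/-- `σ` raises the level by `2`. [cite: DuminilCopinSmirnov2012, §3 (Fig. 3: the levels)] -/
theorem lev_shiftUp (v : HV) : lev (shiftUp v) = lev v + 2 := by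
  show 2 * (v.2.1 + 1) + bit v = 2 * v.2.1 + bit v + 2
  ring

/-- `σ` is a graph automorphism of `hvGraph`. [cite: DuminilCopinSmirnov2012, §3 (Fig. 3: the levels)] -/
theorem adj_shiftUp {u v : HV} : hvGraph.Adj (shiftUp u) (shiftUp v) ↔ hvGraph.Adj u v := by
  obtain ⟨a, b, c⟩ := u
  obtain ⟨a', b', c'⟩ := v
  cases c <;> cases c' <;> simp [hvGraph_adj, HV.AdjRel, shiftUp]
  omega

/-- `O` is adjacent to `σ(w) = (0, 0, true)`. [cite: DuminilCopinSmirnov2012, §3 (Fig. 3: the levels)] -/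
theorem adj_hvOrigin_shiftUp_wOut : hvGraph.Adj hvOrigin (shiftUp wOut) := by decide

/-- `σ` maps the strip domain `S_{T,L}` into `S_{T+1,L+1}`. [cite: DuminilCopinSmirnov2012, §3 (Fig. 3: the domains `S_{T,L}`)] -/
theorem shiftUp_mem_stripV {T L : ℕ} {v : HV} (hv : v ∈ stripV T L) : shiftUp v ∈ stripV (T + 1) (L + 1) := by
  obtain ⟨a, b, c⟩ := v
  rw [mem_stripV_iff] at hv ⊢
  cases c <;> simp [shiftUp, bit] at hv ⊢ <;> omega

/-- **The lift `γ ↦ a · O · σ(γ)`** on vertex lists: `[w, O, v₁, …, u] ↦ [w, O, σ w, σ O, σ v₁, …, σ u]`.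
[cite: BeatonBousquetMelouDeGierDuminilCopinGuttmann2014, §3.1, Proposition 5 (arXiv v5 p. 9: "For 0 < y ≤ 1, μ(y) = μ(1) = μ.")] -/
def liftWalk (P : List HV) : List HV := wOut :: hvOrigin :: P.map shiftUp

/-- The lift is injective. [cite: BeatonBousquetMelouDeGierDuminilCopinGuttmann2014, §3.1, Proposition 5 (arXiv v5 p. 9: "For 0 < y ≤ 1, μ(y) = μ(1) = μ.")] -/
theorem liftWalk_injective : Function.Injective liftWalk := by
  intro P Q h
  simp only [liftWalk, List.cons.injEq, true_and] at h
  exact List.map_injective_iff.2 shiftUp_injective h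

/-- The lift visits two more vertices. [cite: BeatonBousquetMelouDeGierDuminilCopinGuttmann2014, §3.1, Proposition 5 (arXiv v5 p. 9: "For 0 < y ≤ 1, μ(y) = μ(1) = μ.")] -/
theorem mwLen_liftWalk {P : List HV} (h : 2 ≤ P.length) : mwLen (liftWalk P) = mwLen P + 2 := by
  simp only [mwLen, liftWalk, List.length_cons, List.length_map]
  omega

/-- Dropping the last two entries commutes with a long enough `cons` (list bookkeeping). [folklore] -/
private theorem getLast?_dropLast_dropLast_cons {α : Type*} (a : α) {l : List α} (h : 3 ≤ l.length) :
    (a :: l).dropLast.dropLast.getLast? = l.dropLast.dropLast.getLast? := by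
  have h1 : l ≠ [] := by rintro rfl; simp at h
  have h2 : l.dropLast ≠ [] := by
    intro h'; have := congrArg List.length h'; simp at this; omega
  have h3 : l.dropLast.dropLast ≠ [] := by
    intro h'; have := congrArg List.length h'; simp at this; omega
  rw [List.dropLast_cons_of_ne_nil h1, List.dropLast_cons_of_ne_nil h2]
  obtain ⟨m, b, hm⟩ := (List.eq_nil_or_concat l.dropLast.dropLast).resolve_left h3
  rw [hm, List.concat_eq_append, ← List.cons_append, List.getLast?_concat, List.getLast?_concat]

variable {V : Finset HV} {P : List HV}

/-- The visited vertices of the lift: `O`, `σ w`, then the translated visited vertices of `γ`. [cite: BeatonBousquetMelouDeGierDuminilCopinGuttmann2014, §3.1, Proposition 5 (arXiv v5 p. 9: "For 0 < y ≤ 1, μ(y) = μ(1) = μ.")] -/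
theorem IsMidWalk.inner_liftWalk (h : IsMidWalk V P) :
    HV.inner (liftWalk P) = hvOrigin :: shiftUp wOut :: (HV.inner P).map shiftUp := by
  obtain ⟨Q, rfl⟩ := h.exists_eq_cons
  simp [HV.inner, liftWalk]

/-- The lift has exactly one visited vertex on the surface row (namely `O`).
[cite: BeatonBousquetMelouDeGierDuminilCopinGuttmann2014, §3.1 (arXiv v5 p. 8: "`c(ω)` denotes the number of contacts of `ω` with the surface")] -/
theorem IsMidWalk.botContacts_liftWalk {T L : ℕ} (h : IsMidWalk (stripV T L) P) : botContacts (liftWalk P) = 1 := by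
  rw [botContacts, h.inner_liftWalk]
  have hM : ((HV.inner P).map shiftUp).filter (fun v => lev v = 0) = [] := by
    refine List.filter_eq_nil_iff.2 fun v hv => ?_
    obtain ⟨u, hu, rfl⟩ := List.mem_map.1 hv
    obtain ⟨a, b, c⟩ := u
    have hu' := (mem_stripV_iff.1 (h.2.2.2.1 _ hu)).1
    cases c <;> simp [lev_shiftUp, bit] at hu' ⊢ <;> omega
  simp [hM, hvOrigin, wOut, shiftUp, bit]

/-- **The lift of a mid-edge walk in `S_{T,L}` is a mid-edge walk in `S_{T+1,L+1}`.**
[cite: BeatonBousquetMelouDeGierDuminilCopinGuttmann2014, §3.1, Proposition 5 (arXiv v5 p. 9: "For 0 < y ≤ 1, μ(y) = μ(1) = μ.")] -/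
theorem IsMidWalk.liftWalk {T L : ℕ} (h : IsMidWalk (stripV T L) P) :
    IsMidWalk (stripV (T + 1) (L + 1)) (liftWalk P) := by
  have hcm : (P.map shiftUp).IsChain hvGraph.Adj :=
    (List.isChain_map shiftUp).2 (h.1.imp fun a b hab => adj_shiftUp.2 hab)
  have hin := h.inner_liftWalk
  obtain ⟨Q, rfl⟩ := h.exists_eq_cons
  refine ⟨?_, rfl, rfl, ?_, ?_, ?_⟩
  · -- the chain `w, O, σ w, σ O, …`
    simp only [liftWalk, List.map_cons, List.isChain_cons_cons] at hcm ⊢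
    exact ⟨adj_wOut_hvOrigin, adj_hvOrigin_shiftUp_wOut, hcm⟩
  · -- visited vertices lie in `S_{T+1,L+1}`
    rw [hin]
    intro x hx
    rcases List.mem_cons.1 hx with rfl | hx
    · exact hvOrigin_mem_stripV (by omega)
    rcases List.mem_cons.1 hx with rfl | hx
    · rw [mem_stripV_iff]; simp [shiftUp, wOut, bit]; omega
    obtain ⟨u, hu, rfl⟩ := List.mem_map.1 hx
    exact shiftUp_mem_stripV (h.2.2.2.1 u hu)
  · -- self-avoiding
    rw [hin, List.nodup_cons, List.nodup_cons]
    refine ⟨?_, ?_, h.2.2.2.2.1.map shiftUp_injective⟩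
    · intro hO
      rcases List.mem_cons.1 hO with hO | hO
      · simp [hvOrigin, wOut, shiftUp] at hO
      obtain ⟨⟨a, b, c⟩, hu, hOu⟩ := List.mem_map.1 hO
      have := (mem_stripV_iff.1 (h.2.2.2.1 _ hu)).1
      simp [hvOrigin, shiftUp] at hOu this
      omega
    · intro hw
      obtain ⟨u, hu, hwu⟩ := List.mem_map.1 hw
      obtain rfl := shiftUp_injective hwu
      exact wOut_not_mem_stripV T L (h.2.2.2.1 _ hu)
  · -- the final half-edge does not retrace
    have hl := h.2.2.2.2.2
    rcases Q with _ | ⟨e, Q⟩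
    · simp [liftWalk, shiftUp, hvOrigin, wOut]
    · have hne : ((wOut :: hvOrigin :: e :: Q).map shiftUp) ≠ [] := by simp
      have hlen : 3 ≤ ((wOut :: hvOrigin :: e :: Q).map shiftUp).length := by simp
      rw [liftWalk, getLast?_dropLast_dropLast_cons wOut (by simp), getLast?_dropLast_dropLast_cons hvOrigin hlen,
        List.getLast?_cons_cons, List.getLast?_cons_of_ne_nil hne, ← List.map_dropLast, ← List.map_dropLast,
        List.getLast?_map, List.getLast?_map]
      exact fun heq => hl (Option.map_injective shiftUp_injective heq)

/-- **`y · C_n(1) ≤ C_{n+2}(y)` for every `y ≥ 0`** — the lift injects the `n`-vertex half-plane walks into the `(n+2)`-vertex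
ones with exactly one surface vertex.
[cite: BeatonBousquetMelouDeGierDuminilCopinGuttmann2014, §3.1, Proposition 5 (arXiv v5 p. 9: "For 0 < y ≤ 1, μ(y) = μ(1) = μ.")] -/
theorem mul_hpCoeff_one_le {y : ℝ} (hy0 : 0 ≤ y) (n : ℕ) : y * hpCoeff n 1 ≤ hpCoeff (n + 2) y := by
  classical
  set F := (midWalks (stripV n n)).filter (fun P => mwLen P = n) with hF
  have himg : F.image liftWalk ⊆ (midWalks (stripV (n + 2) (n + 2))).filter (fun P => mwLen P = n + 2) := by
    intro P' hP'
    obtain ⟨P, hP, rfl⟩ := mem_image.1 hP'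
    rw [mem_filter, mem_midWalks_iff] at hP ⊢
    refine ⟨hP.1.liftWalk.mono ((stripV_mono_T (by omega)).trans (stripV_mono_L (by omega))), ?_⟩
    rw [mwLen_liftWalk hP.1.two_le_length, hP.2]
  calc y * hpCoeff n 1 = ∑ _P ∈ F, y := by simp [hpCoeff, hF, mul_comm]
    _ = ∑ _P' ∈ F.image liftWalk, y := by rw [sum_image fun _ _ _ _ h => liftWalk_injective h]
    _ = ∑ P' ∈ F.image liftWalk, y ^ botContacts P' := by
      refine sum_congr rfl fun P' hP' => ?_
      obtain ⟨P, hP, rfl⟩ := mem_image.1 hP'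
      rw [(mem_midWalks_iff.1 (mem_filter.1 hP).1).botContacts_liftWalk, pow_one]
    _ ≤ hpCoeff (n + 2) y := sum_le_sum_of_subset_of_nonneg himg fun _ _ _ => pow_nonneg hy0 _

/-- **`μ(y) ≥ μ` for every `y > 0`** (junk-free: every rate `0 ≤ r < μ` is reached infinitely often), UNCONDITIONALLY: for
`y ≥ 1` by `growthGe_of_one_le`, for `0 < y < 1` by `y · C_n(1) ≤ C_{n+2}(y)` and `GrowthGe 1`.
[cite: BeatonBousquetMelouDeGierDuminilCopinGuttmann2014, §3.1, Proposition 5 (arXiv v5 p. 9: "For 0 < y ≤ 1, μ(y) = μ(1) = μ." and "μ(y) ≥ max(μ, √y)" — the `μ` half)] -/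
theorem growthGe_of_pos {y : ℝ} (hy : 0 < y) : GrowthGe y := by
  intro r hr0 hr
  rcases hr0.eq_or_lt with rfl | hr0'
  · refine Filter.Eventually.frequently (Filter.eventually_atTop.2 ⟨1, fun n hn => ?_⟩)
    rw [zero_pow (by omega)]
    exact hpCoeff_nonneg n hy.le
  obtain ⟨r', hrr', hr'μ⟩ := exists_between hr
  have h1 := growthGe_of_one_le le_rfl r' (hr0.trans hrr'.le) hr'μ
  have hev : ∀ᶠ n : ℕ in atTop, r ^ (n + 2) ≤ y * r' ^ n := by
    have hq : 1 < r' / r := (one_lt_div hr0').2 hrr'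
    filter_upwards [(tendsto_pow_atTop_atTop_of_one_lt hq).eventually_ge_atTop (r ^ 2 / y)] with n hn
    rw [div_pow, div_le_div_iff₀ hy (pow_pos hr0' n)] at hn
    calc r ^ (n + 2) = r ^ 2 * r ^ n := by ring
      _ ≤ r' ^ n * y := hn
      _ = y * r' ^ n := mul_comm _ _
  have h2 : ∃ᶠ n : ℕ in atTop, r ^ (n + 2) ≤ hpCoeff (n + 2) y :=
    (h1.and_eventually hev).mono fun n hn =>
      hn.2.trans ((mul_le_mul_of_nonneg_left hn.1 hy.le).trans (mul_hpCoeff_one_le hy.le n))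
  rw [Filter.frequently_atTop] at h2 ⊢
  intro N
  obtain ⟨n, hn, h⟩ := h2 N
  exact ⟨n + 2, by omega, h⟩

/-- **`0 < y < 1 + √2` ⇒ `limsup C_n(y)^{1/n} = μ`** (both halves: BBdGDCG14 Prop. 5 "`μ(y) = μ` if `y ≤ y_c`", off the endpoint),
unconditionally. [cite: BeatonBousquetMelouDeGierDuminilCopinGuttmann2014, §3.1, Proposition 5 (arXiv v5 p. 9: "μ(y) = μ if y ≤ y_c")] -/
theorem growth_eq_holds_of_pos {y : ℝ} (hy0 : 0 < y) (hy : y < 1 + Real.sqrt 2) : GrowthLe y ∧ GrowthGe y :=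
  ⟨growthLe_holds hy0 hy, growthGe_of_pos hy0⟩


/-! ### The critical point itself: `GrowthLe (1 + √2)` by the rescaling bound `C_n(y') ≤ (y'/y)ⁿ · C_n(y)`

Printed Prop. 5 puts `y = y_c` on the "`= μ`" side (there: continuity of the log-convex limit `μ(·)`).  In limsup language no
limit and no convexity are needed: a walk's surface contacts are visited vertices, `c(γ) ≤ ℓ(γ)`, so `C_n(y') ≤ (y'/y)ⁿ · C_n(y)`
for `0 < y ≤ y'`; given a rate `r > μ` at `y_c`, apply `GrowthLe y` at `y = y_c (μ + r)/(2r) < y_c` with the rate `(μ + r)/2`.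
Result: `GrowthLe y ↔ y ≤ 1 + √2 = hexSurfaceYc` and `GrowthGt y ↔ 1 + √2 < y` for EVERY `y > 0` — the sup-radius `y_c` of
the tree (`hexSurfaceYc`, T1/T3) IS the growth-rate threshold, as Glazman–Manolescu assert of [BBMDG+14]'s definition. -/

/-- `c(γ) ≤ ℓ(γ)`: surface contacts are visited vertices.
[cite: BeatonBousquetMelouDeGierDuminilCopinGuttmann2014, §3.1 (arXiv v5 p. 8: "`c(ω)` denotes the number of contacts of `ω` with the surface (i.e., the number of vertices of the surface visited by `ω`)")] -/
theorem IsMidWalk.botContacts_le_mwLen (h : IsMidWalk V P) : botContacts P ≤ mwLen P := by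
  rw [botContacts, ← h.length_inner]
  exact List.length_filter_le _ _

/-- **Rescaling: `C_n(y') ≤ (y'/y)ⁿ · C_n(y)` for `0 < y ≤ y'`** (`C_n` is a polynomial of degree `≤ n` with non-negative coefficients).
[cite: BeatonBousquetMelouDeGierDuminilCopinGuttmann2014, §3.1 (arXiv v5 p. 8: `C_k^+(y)` "a polynomial in `y`")] -/
theorem hpCoeff_le_pow_mul {y y' : ℝ} (hy : 0 < y) (hyy' : y ≤ y') (n : ℕ) : hpCoeff n y' ≤ (y' / y) ^ n * hpCoeff n y := by
  rw [hpCoeff, hpCoeff, mul_sum]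
  refine sum_le_sum fun P hP => ?_
  obtain ⟨hPm, hPn⟩ := mem_filter.1 hP
  have hc : botContacts P ≤ n := hPn ▸ (mem_midWalks_iff.1 hPm).botContacts_le_mwLen
  have h1 : 1 ≤ y' / y := (one_le_div hy).2 hyy'
  calc y' ^ botContacts P = (y' / y) ^ botContacts P * y ^ botContacts P := by
        rw [← mul_pow, div_mul_cancel₀ _ hy.ne']
    _ ≤ (y' / y) ^ n * y ^ botContacts P :=
        mul_le_mul_of_nonneg_right (pow_le_pow_right₀ h1 hc) (pow_nonneg hy.le _)

/-- **`GrowthLe` passes to right endpoints:** if every `y' ∈ (0, y)` has rate `≤ μ`, so does `y` (rescaling with `y'/y ↑ 1`).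
[cite: BeatonBousquetMelouDeGierDuminilCopinGuttmann2014, §3.1, Proposition 5 (arXiv v5 p. 9: "μ(y) = μ if y ≤ y_c" — the endpoint included)] -/
theorem growthLe_of_forall_lt {y : ℝ} (hy : 0 < y) (h : ∀ y' : ℝ, 0 < y' → y' < y → GrowthLe y') : GrowthLe y := by
  intro r hr
  have hμ0 : 0 < hexConnectiveConstant := by
    rw [hexConnectiveConstant_eq_inv]; exact inv_pos.2 hexCriticalFugacity_pos_lt_one.1
  have hr0 : 0 < r := hμ0.trans hr
  set q : ℝ := (hexConnectiveConstant + r) / (2 * r) with hq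
  have hq0 : 0 < q := by positivity
  have hq1 : q < 1 := by rw [hq, div_lt_one (by positivity)]; linarith
  have hy'0 : 0 < y * q := mul_pos hy hq0
  have hy'y : y * q < y := mul_lt_of_lt_one_right hy hq1
  have hrate : hexConnectiveConstant < (hexConnectiveConstant + r) / 2 := by linarith
  filter_upwards [h (y * q) hy'0 hy'y _ hrate] with n hn
  calc hpCoeff n y ≤ (y / (y * q)) ^ n * hpCoeff n (y * q) := hpCoeff_le_pow_mul hy'0 hy'y.le n
    _ ≤ (y / (y * q)) ^ n * ((hexConnectiveConstant + r) / 2) ^ n :=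
        mul_le_mul_of_nonneg_left hn (pow_nonneg (div_nonneg hy.le hy'0.le) n)
    _ = r ^ n := by
        rw [← mul_pow]
        congr 1
        rw [hq]
        field_simp

/-- **`GrowthLe (1 + √2)`: AT the critical point the half-plane coefficients still grow at rate `≤ μ`**, unconditionally.
[cite: BeatonBousquetMelouDeGierDuminilCopinGuttmann2014, §3.1, Proposition 5 (arXiv v5 p. 9: "μ(y) = μ if y ≤ y_c" — the endpoint included)] -/
theorem growthLe_criticalPoint : GrowthLe (1 + Real.sqrt 2) :=
  growthLe_of_forall_lt (by positivity) fun _ hy0 hy => growthLe_holds hy0 hy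

/-- Parametric form of the full dichotomy (inputs T3's two faces).
[cite: BeatonBousquetMelouDeGierDuminilCopinGuttmann2014, Theorem 2 (arXiv v5 p. 3) with §3.1, Proposition 5 (p. 9)] -/
theorem growthLe_iff_le_of_faces (hBel : HPBelow) (hAb : HPAbove) {y : ℝ} (hy0 : 0 < y) :
    GrowthLe y ↔ y ≤ 1 + Real.sqrt 2 := by
  constructor
  · intro h
    by_contra hgt
    rw [not_le] at hgt
    exact not_growthLe_of_growthGt (growthGt_of_gt hAb hgt) h
  · intro hle
    rcases hle.lt_or_eq with hlt | rfl
    · exact growthLe_of_lt hBel hy0 hlt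
    · exact growthLe_of_forall_lt hy0 fun _ h0 h => growthLe_of_lt hBel h0 h

/-- **BBdGDCG14 Theorem 2 / Prop. 5 — the FULL dichotomy in growth-rate form, NO hypothesis beyond `0 < y`:**
`limsup_n C_n(y)^{1/n} ≤ μ ↔ y ≤ 1 + √2`.
[cite: BeatonBousquetMelouDeGierDuminilCopinGuttmann2014, Theorem 2 (arXiv v5 p. 3) with §3.1, Proposition 5 (p. 9: "μ(y) = μ if y ≤ y_c, > μ if y > y_c")] -/
theorem growthLe_iff_le {y : ℝ} (hy0 : 0 < y) : GrowthLe y ↔ y ≤ 1 + Real.sqrt 2 :=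
  growthLe_iff_le_of_faces hpBelow_holds hpAbove_holds hy0

/-- **… and `limsup_n C_n(y)^{1/n} > μ ↔ 1 + √2 < y`** (`0 < y`).
[cite: BeatonBousquetMelouDeGierDuminilCopinGuttmann2014, Theorem 2 (arXiv v5 p. 3) with §3.1, Proposition 5 (p. 9: "μ(y) > μ if y > y_c")] -/
theorem growthGt_iff {y : ℝ} (hy0 : 0 < y) : GrowthGt y ↔ 1 + Real.sqrt 2 < y := by
  constructor
  · intro h
    by_contra hle
    rw [not_lt] at hle
    exact not_growthLe_of_growthGt h ((growthLe_iff_le hy0).2 hle)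
  · exact growthGt_holds

/-- **`0 < y ≤ 1 + √2` ⇒ `limsup C_n(y)^{1/n} = μ`** (both halves, endpoint included), unconditionally.
[cite: BeatonBousquetMelouDeGierDuminilCopinGuttmann2014, §3.1, Proposition 5 (arXiv v5 p. 9: "μ(y) = μ if y ≤ y_c")] -/
theorem growth_eq_holds_of_le {y : ℝ} (hy0 : 0 < y) (hy : y ≤ 1 + Real.sqrt 2) : GrowthLe y ∧ GrowthGe y :=
  ⟨(growthLe_iff_le hy0).2 hy, growthGe_of_pos hy0⟩

/-- **The tree's sup-radius `y_c` IS the growth-rate threshold:** `limsup C_n(y)^{1/n} ≤ μ ↔ y ≤ hexSurfaceYc` for every `y > 0`.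
[cite: GlazmanManolescu2019, Definition 1.1 and the following paragraph (arXiv v3 p. 5: "This is exactly the definition of critical fugacity used in [BBMDG+14]"); BeatonBousquetMelouDeGierDuminilCopinGuttmann2014, §3.1, Proposition 5 (arXiv v5 p. 9)] -/
theorem growthLe_iff_le_hexSurfaceYc {y : ℝ} (hy0 : 0 < y) : GrowthLe y ↔ y ≤ hexSurfaceYc := by
  rw [hexSurfaceYc_eq]
  exact growthLe_iff_le hy0

end Literature.Probability.RandomPlanarGeometry.SAW.HV
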